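import Literature.AnabelianGeometry.EtaleTheta.Discharge.Sec2Cor218iAtModelTateNonInner
import Literature.AnabelianGeometry.EtaleTheta.SettingModelCyclotomicCharacterLevelFour
import Literature.AnabelianGeometry.EtaleTheta.SettingModelTateMuTwo
import HarnessLib

/-!
# [EtTh] Thm. 1.6 (i) / Cor. 2.18 (i) (F-0620) AT THE STAGE-2 TATE MODEL `ThetaSetting.modelχq p i 2` over ARBITRARY
# (non-inner) automorphisms of `G_{ℚ_p}`, part 2: THE THEOREMS, BY `p mod 4`
# (proof-only; row «THM16I-NONINNER-AT-MODELTATE», K-L6; successor item (ii) of «COR218I-AT-MODELTATE»)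

S. Mochizuki, *The étale theta function and its Frobenioid-theoretic manifestations* [EtTh], Publ. RIMS **45**
(2009): Thm. 1.6 (i), PRIMS PDF p. 24 («`γ(Π^tp_{Ÿα}) = Π^tp_{Ÿβ}`») [cite: MochizukiEtTh2009, Thm 1.6 (i) p.24];
Cor. 2.18 (i), p. 60 (the named fact `RigidData.Cor218_i`, FACT-LIST F-0620) [cite: MochizukiEtTh2009, Cor 2.18(i) p.60];
Prop. 2.4, p. 38 PRIMS / kurims p. 35 («any automorphism of `Π^tp_{X̲̲}` induces automorphisms of `Π^tp_X`» — the shape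
of `hextΔ`) [cite: MochizukiEtTh2009, Prop 2.4 p.38]. Classical input: `−1 ∈ (ℚ_p^×)² ⟺ p ≡ 1 (4)`
[cite: Serre1973, Ch. II §3.3 Cor. of Thm 4] (`SettingModelCyclotomicCharacterLevelFour`).

abc-iut cell, layer L6 / K-L6 instance column, seat abc-iut-L6-d6 (gen 6), row «THM16I-NONINNER-AT-MODELTATE».
PROOF-ONLY: no definition, no instance, no `Prop`-valued fact; inputs BY NAME (part 1
`Sec2Cor218iAtModelTateNonInner`: `left_apply_inr_mem_dY_two_iff`, `levelChar_four_sub_one_mul_eq`,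
`level_two_kappaP_eq_of_levelChar_four_eq_one`; gen 5 `Sec2Cor218iAtModelTateOfExtends`; abc-iut-L2-d1
`DoubleUnderline.rigidData_cor218_i_of_extends`; abc-iut-w5-d051 `map_dY_eq` / `hHat_y_apply_eq`).

WHAT THIS FILE PROVES (numbers, not adjectives). `D = modelχq p i 2`; `Γ` ranges over topological automorphisms of
`Π^tp_X` with `Γ(Δ^tp_X) = Δ^tp_X`; NO hypothesis on the induced automorphism `ν` of `G_{ℚ_p}`.
§3 (a) `map_GtpYdd_eq_of_map_deltaTemp_eq_of_even` — `i` EVEN ⇒ `Γ(Π^tp_Ÿ) = Π^tp_Ÿ` for every such `Γ`, every `p`;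
   (b) `map_GtpYdd_eq_of_map_deltaTemp_eq_of_levelChar_four` — `χ₄ ≡ 1` on `G_{ℚ_p}` ⇒ the same for EVERY `i`;
   (b′) `map_GtpYdd_eq_of_map_deltaTemp_eq_of_mod_four_eq_one` — **`p ≡ 1 (mod 4)` ⇒ Thm. 1.6 (i) at `modelχq p i 2` for
   every `Δ`-stabilising `Γ` over ANY automorphism of `G_{ℚ_p}`**, in particular at the instance of record `(i, j) = (1, 2)`.
§4 `rigidData_cor218_i_modelχq_of_extends_of_levelChar_four` / `_of_mod_four_eq_one` / `_of_even` — F-0620 `Cor218_i` at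
   `modelχq p i 2` (every `E`, `C`, `μ`, `hC`, `hS`, `h15`, empty labelling) FOLLOWS from `hextΔ` ALONE when `p ≡ 1 (4)`
   (or `i` even): gen 5's `rigidData_cor218_i_modelχq_of_extends_of_hgal` WITHOUT its (HGAL) hypothesis.
§5 THE RESIDUAL at `p ≢ 1 (mod 4)`, `i` odd (⊇ the instance of record): `map_GtpYdd_eq_iff_levelHom_two_y_eq_zero` —
   **`Γ(Π^tp_Ÿ) = Π^tp_Ÿ ⟺ the b-exponent of Γ(a) is EVEN`** (`y(ĥ₂((Γ(inl a)).left)) = 0`); the two directions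
   separately: `map_GtpYdd_le_of_levelHom_two_y_eq_zero` (every `p`, `i`) and `levelHom_two_y_eq_zero_of_map_GtpYdd_le`
   (`i` odd, some `χ₄(τ₀) ≠ 1`).
K-L6 CONSEQUENCE (bookkeeping BY NAME, lead's call): Def1.1 → Cor1.11 @ modelTate residual {hextΔ, (HGAL)} (gen 5) becomes
{hextΔ} for `p ≡ 1 (mod 4)`; for `p ≢ 1 (mod 4)` the (HGAL)-free residual of the `Ÿ̲̲`-clause is the explicit parity
condition of §5 — whether a `Δ`-stabilising `Γ` of odd parity exists is the `Aut(G_{ℚ_p})` question of the gen-5 memo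
(not attempted, reason: no structure theory of `G_{ℚ_p}` / `Aut(F̂₂)` in tree or Mathlib).

HONEST LABEL: `modelχq` is a SEMI-SYNTHETIC model of the typed [EtTh] §1 interface (statement/model-pair evidence);
F-0620 stays a FACT-policy row; `hextΔ` is a hypothesis BY NAME ([EtTh] Prop. 2.4 shape), not endorsed; nothing of
[EtTh] (refereed) is asserted beyond the tree's proofs; no side is taken on [IUTchIII] Cor. 3.12; typed ≠ proved;
nothing here says abc is proved or refuted.
-/

noncomputable section

namespace Literature.AnabelianGeometry.EtaleTheta

namespace SettingModel

open Literature.AnabelianGeometry.SemiGraphs Function Topology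

variable (p : ℕ) [Fact p.Prime] (i : ℤ)

/-- Units of `ℤ/2` are `1`. [folklore] -/
private theorem zmod_two_eq_one_of_mul_eq_one' : ∀ a b : ZMod 2, a * b = 1 → a = 1 := by decide

/-! ## §3. Thm. 1.6 (i) at `modelχq p i 2` without the inner hypothesis -/

/-- One inclusion, from a level-2 equality `κ₂(σ)^i = κ₂(νσ)^i` for all `σ`. [cite: MochizukiEtTh2009, Thm 1.6 (i) p.24] -/
theorem apply_mem_GtpYdd_of_level_two_eq (Γ : PiTpχq p i 2 ≃ₜ* PiTpχq p i 2)
    (hΔ : (curveχq p i 2).DeltaTemp.map Γ.toMulEquiv.toMonoidHom = (curveχq p i 2).DeltaTemp)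
    (hlev : ∀ σ : GQp p, ZHatLevel.level 2 (kappaP p σ ^ i) =
      ZHatLevel.level 2 (kappaP p (Γ (SemidirectProduct.inr σ)).right ^ i))
    {g : PiTpχq p i 2} (hg : g ∈ (ThetaSetting.modelχq p i 2 even_two).GtpYdd) :
    Γ g ∈ (ThetaSetting.modelχq p i 2 even_two).GtpYdd := by
  obtain ⟨φ, hφ⟩ := exists_restrict_of_map_deltaTemp_eq p i Γ hΔ
  rw [mem_GtpYdd_modelχq_iff] at hg ⊢
  have hdec : Γ g = SemidirectProduct.inl (φ g.left) * Γ (SemidirectProduct.inr g.right) := by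
    conv_lhs => rw [← SemidirectProduct.inl_left_mul_inr_right g]
    rw [map_mul, hφ]
  rw [hdec, SemidirectProduct.mul_left, SemidirectProduct.left_inl, SemidirectProduct.right_inl, map_one,
    MulAut.one_apply]
  exact (dY 2).mul_mem ((apply_mem_dY_iff φ 2 _).mpr hg)
    ((left_apply_inr_mem_dY_two_iff p i Γ φ hφ g.right).mpr (hlev g.right))

/-- **(a) EVEN `i`: every `Δ^tp_X`-stabilising topological automorphism of `Π^tp_X(modelχq p i 2)` maps `Π^tp_Ÿ` ONTO
itself** — no hypothesis on the induced automorphism of `G_{ℚ_p}` (at level `2` the inner part `b^{κ_p^i}` is then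
trivial). [cite: MochizukiEtTh2009, Thm 1.6 (i) p.24] -/
theorem map_GtpYdd_eq_of_map_deltaTemp_eq_of_even (hi : Even i) (Γ : PiTpχq p i 2 ≃ₜ* PiTpχq p i 2)
    (hΔ : (curveχq p i 2).DeltaTemp.map Γ.toMulEquiv.toMonoidHom = (curveχq p i 2).DeltaTemp) :
    (ThetaSetting.modelχq p i 2 even_two).GtpYdd.map Γ.toMulEquiv.toMonoidHom =
      (ThetaSetting.modelχq p i 2 even_two).GtpYdd := by
  have hlev : ∀ (Γ' : PiTpχq p i 2 ≃ₜ* PiTpχq p i 2) (σ : GQp p), ZHatLevel.level 2 (kappaP p σ ^ i) =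
      ZHatLevel.level 2 (kappaP p (Γ' (SemidirectProduct.inr σ)).right ^ i) := fun Γ' σ => by
    rw [level_two_zpow_of_even hi, level_two_zpow_of_even hi]
  refine le_antisymm ?_ ?_
  · rintro _ ⟨g, hg, rfl⟩
    exact apply_mem_GtpYdd_of_level_two_eq p i Γ hΔ (hlev Γ) hg
  · intro g hg
    exact ⟨Γ.symm g, apply_mem_GtpYdd_of_level_two_eq p i Γ.symm (map_deltaTempχq_symm_eq p i Γ hΔ) (hlev Γ.symm) hg,
      Γ.apply_symm_apply g⟩

/-- **(b) `χ₄ ≡ 1` on `G_{ℚ_p}`: every `Δ^tp_X`-stabilising topological automorphism of `Π^tp_X(modelχq p i 2)` maps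
`Π^tp_Ÿ` ONTO itself, for EVERY `i`** — no hypothesis on the induced automorphism of `G_{ℚ_p}`.
[cite: MochizukiEtTh2009, Thm 1.6 (i) p.24] -/
theorem map_GtpYdd_eq_of_map_deltaTemp_eq_of_levelChar_four
    (h4 : ∀ τ : GQp p, ZHatLevel.levelChar 4 (chi p τ) = 1) (Γ : PiTpχq p i 2 ≃ₜ* PiTpχq p i 2)
    (hΔ : (curveχq p i 2).DeltaTemp.map Γ.toMulEquiv.toMonoidHom = (curveχq p i 2).DeltaTemp) :
    (ThetaSetting.modelχq p i 2 even_two).GtpYdd.map Γ.toMulEquiv.toMonoidHom =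
      (ThetaSetting.modelχq p i 2 even_two).GtpYdd := by
  have hlev : ∀ (Γ' : PiTpχq p i 2 ≃ₜ* PiTpχq p i 2),
      (curveχq p i 2).DeltaTemp.map Γ'.toMulEquiv.toMonoidHom = (curveχq p i 2).DeltaTemp →
      ∀ σ : GQp p, ZHatLevel.level 2 (kappaP p σ ^ i) =
        ZHatLevel.level 2 (kappaP p (Γ' (SemidirectProduct.inr σ)).right ^ i) := fun Γ' hΔ' σ => by
    obtain ⟨φ, hφ⟩ := exists_restrict_of_map_deltaTemp_eq p i Γ' hΔ'
    rw [map_zpow, map_zpow, level_two_kappaP_eq_of_levelChar_four_eq_one p i Γ' φ hφ σ (h4 _)]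
  refine le_antisymm ?_ ?_
  · rintro _ ⟨g, hg, rfl⟩
    exact apply_mem_GtpYdd_of_level_two_eq p i Γ hΔ (hlev Γ hΔ) hg
  · intro g hg
    exact ⟨Γ.symm g, apply_mem_GtpYdd_of_level_two_eq p i Γ.symm (map_deltaTempχq_symm_eq p i Γ hΔ)
      (hlev Γ.symm (map_deltaTempχq_symm_eq p i Γ hΔ)) hg, Γ.apply_symm_apply g⟩

/-- **(b′) `p ≡ 1 (mod 4)`: Thm. 1.6 (i) at `modelχq p i 2` for EVERY `Δ^tp_X`-stabilising topological automorphism of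
`Π^tp_X`, over ANY (possibly non-inner) automorphism of `G_{ℚ_p}`** — in particular at the instance of record
`(i, j) = (1, 2)`. [cite: MochizukiEtTh2009, Thm 1.6 (i) p.24] -/
theorem map_GtpYdd_eq_of_map_deltaTemp_eq_of_mod_four_eq_one (hp : p % 4 = 1)
    (Γ : PiTpχq p i 2 ≃ₜ* PiTpχq p i 2)
    (hΔ : (curveχq p i 2).DeltaTemp.map Γ.toMulEquiv.toMonoidHom = (curveχq p i 2).DeltaTemp) :
    (ThetaSetting.modelχq p i 2 even_two).GtpYdd.map Γ.toMulEquiv.toMonoidHom =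
      (ThetaSetting.modelχq p i 2 even_two).GtpYdd :=
  map_GtpYdd_eq_of_map_deltaTemp_eq_of_levelChar_four p i (levelChar_four_chi_eq_one_of_mod_four_eq_one p hp) Γ hΔ

/-! ## §4. F-0620 `Cor218_i` at the record's shape FROM the extension property ALONE -/

/-- **F-0620 `Cor218_i` at `modelχq p i 2`, for every étale-theta datum `E`, every `X̲̲`-choice `C`, every level `μ`, `hC`,
`hS`, `h15` and the EMPTY cusp labelling, FROM `hextΔ` alone, GIVEN `χ₄ ≡ 1` on `G_{ℚ_p}`** (gen 5's
`rigidData_cor218_i_modelχq_of_extends_of_hgal` WITHOUT its (HGAL) hypothesis): the three `L`-free core clauses are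
abc-iut-L2-d1's `rigidData_cor218_i_of_extends`, the `Ÿ̲̲`-clause is §3 (b), labels are empty. CONDITIONAL-AT-MODEL:
F-0620@instance is NOT decided. [cite: MochizukiEtTh2009, Cor 2.18(i) p.60] -/
theorem rigidData_cor218_i_modelχq_of_extends_of_levelChar_four
    (h4 : ∀ τ : GQp p, ZHatLevel.levelChar 4 (chi p τ) = 1)
    {E : (ThetaSetting.modelχq p i 2 even_two).EtaleThetaData} {l : ℕ} (C : E.DoubleUnderline l) {N : ℕ+}
    (μ : (ThetaSetting.modelχq p i 2 even_two).CyclotomeMod l N) (hC : (ThetaSetting.modelχq p i 2 even_two).Compat)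
    (hS : (ThetaSetting.modelχq p i 2 even_two).Sec2Hyps) (h15 : ThetaSetting.Prop15iii E hC)
    (hext : ∀ γ : ↥C.Huu ≃ₜ* ↥C.Huu, ∃ Γ : PiTpχq p i 2 ≃ₜ* PiTpχq p i 2,
      (∀ h : C.Huu, Γ (h : PiTpχq p i 2) = ((γ h : C.Huu) : PiTpχq p i 2)) ∧
        (curveχq p i 2).DeltaTemp.map Γ.toMulEquiv.toMonoidHom = (curveχq p i 2).DeltaTemp) :
    (C.rigidData μ hC hS h15 ⟨fun _ => ∅, fun _ => ∅, fun _ => rfl⟩).Cor218_i := by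
  refine C.rigidData_cor218_i_of_extends μ hC hS h15 _ (fun γ => ?_) (fun γ a => Set.image_empty _)
  obtain ⟨Γ, hΓ, hΔ⟩ := hext γ
  exact ⟨Γ, hΓ, hΔ, map_GtpYdd_eq_of_map_deltaTemp_eq_of_levelChar_four p i h4 Γ hΔ⟩

/-- **F-0620 `Cor218_i` at `modelχq p i 2` FROM `hextΔ` ALONE, for `p ≡ 1 (mod 4)`** (in particular at the Tate model
of record `modelχq p 1 2`). CONDITIONAL-AT-MODEL. [cite: MochizukiEtTh2009, Cor 2.18(i) p.60] -/
theorem rigidData_cor218_i_modelχq_of_extends_of_mod_four_eq_one (hp : p % 4 = 1)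
    {E : (ThetaSetting.modelχq p i 2 even_two).EtaleThetaData} {l : ℕ} (C : E.DoubleUnderline l) {N : ℕ+}
    (μ : (ThetaSetting.modelχq p i 2 even_two).CyclotomeMod l N) (hC : (ThetaSetting.modelχq p i 2 even_two).Compat)
    (hS : (ThetaSetting.modelχq p i 2 even_two).Sec2Hyps) (h15 : ThetaSetting.Prop15iii E hC)
    (hext : ∀ γ : ↥C.Huu ≃ₜ* ↥C.Huu, ∃ Γ : PiTpχq p i 2 ≃ₜ* PiTpχq p i 2,
      (∀ h : C.Huu, Γ (h : PiTpχq p i 2) = ((γ h : C.Huu) : PiTpχq p i 2)) ∧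
        (curveχq p i 2).DeltaTemp.map Γ.toMulEquiv.toMonoidHom = (curveχq p i 2).DeltaTemp) :
    (C.rigidData μ hC hS h15 ⟨fun _ => ∅, fun _ => ∅, fun _ => rfl⟩).Cor218_i :=
  rigidData_cor218_i_modelχq_of_extends_of_levelChar_four p i
    (levelChar_four_chi_eq_one_of_mod_four_eq_one p hp) C μ hC hS h15 hext

/-- **F-0620 `Cor218_i` at `modelχq p i 2` FROM `hextΔ` ALONE, for EVEN `i`** (any `p`). CONDITIONAL-AT-MODEL.
[cite: MochizukiEtTh2009, Cor 2.18(i) p.60] -/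
theorem rigidData_cor218_i_modelχq_of_extends_of_even (hi : Even i)
    {E : (ThetaSetting.modelχq p i 2 even_two).EtaleThetaData} {l : ℕ} (C : E.DoubleUnderline l) {N : ℕ+}
    (μ : (ThetaSetting.modelχq p i 2 even_two).CyclotomeMod l N) (hC : (ThetaSetting.modelχq p i 2 even_two).Compat)
    (hS : (ThetaSetting.modelχq p i 2 even_two).Sec2Hyps) (h15 : ThetaSetting.Prop15iii E hC)
    (hext : ∀ γ : ↥C.Huu ≃ₜ* ↥C.Huu, ∃ Γ : PiTpχq p i 2 ≃ₜ* PiTpχq p i 2,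
      (∀ h : C.Huu, Γ (h : PiTpχq p i 2) = ((γ h : C.Huu) : PiTpχq p i 2)) ∧
        (curveχq p i 2).DeltaTemp.map Γ.toMulEquiv.toMonoidHom = (curveχq p i 2).DeltaTemp) :
    (C.rigidData μ hC hS h15 ⟨fun _ => ∅, fun _ => ∅, fun _ => rfl⟩).Cor218_i := by
  refine C.rigidData_cor218_i_of_extends μ hC hS h15 _ (fun γ => ?_) (fun γ a => Set.image_empty _)
  obtain ⟨Γ, hΓ, hΔ⟩ := hext γ
  exact ⟨Γ, hΓ, hΔ, map_GtpYdd_eq_of_map_deltaTemp_eq_of_even p i hi Γ hΔ⟩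

/-! ## §5. The residual at `p ≢ 1 (mod 4)`: the parity of the `b`-exponent of `Γ(a)` -/


/-- `(χ − 1)·c₁` vanishes in `ℤ/4` when `χ` is a unit and `c₁` is even. [folklore] -/
private theorem zmod_four_sub_one_mul_eq_zero :
    ∀ χ v c : ZMod ((4 : ℕ+) : ℕ), χ * v = 1 →
      ZMod.castHom (show ((2 : ℕ+) : ℕ) ∣ ((4 : ℕ+) : ℕ) by norm_num) (ZMod ((2 : ℕ+) : ℕ)) c = 0 →
        (χ - 1) * c = 0 := by
  change ∀ χ v c : ZMod 4, χ * v = 1 → ZMod.castHom _ (ZMod 2) c = 0 → (χ - 1) * c = 0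
  decide

/-- `(χ − 1)·c₁ = 0` in `ℤ/4` with `χ` a unit `≠ 1` forces `c₁` even. [folklore] -/
private theorem zmod_four_castHom_eq_zero_of_mul_eq_zero :
    ∀ χ v c : ZMod ((4 : ℕ+) : ℕ), χ * v = 1 → χ ≠ 1 → (χ - 1) * c = 0 →
      ZMod.castHom (show ((2 : ℕ+) : ℕ) ∣ ((4 : ℕ+) : ℕ) by norm_num) (ZMod ((2 : ℕ+) : ℕ)) c = 0 := by
  change ∀ χ v c : ZMod 4, χ * v = 1 → χ ≠ 1 → (χ - 1) * c = 0 → ZMod.castHom _ (ZMod 2) c = 0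
  decide

/-- **(c, ⇐) If the `b`-exponent of `Γ(a)` is EVEN then `Γ(Π^tp_Ÿ) ⊆ Π^tp_Ÿ`** — every `p`, every `i`, every
`Δ^tp_X`-stabilising `Γ` (the level-4 relation then reads `0 = 2·(κ₄σ − κ₄(νσ))`).
[cite: MochizukiEtTh2009, Thm 1.6 (i) p.24] -/
theorem map_GtpYdd_le_of_levelHom_two_y_eq_zero (Γ : PiTpχq p i 2 ≃ₜ* PiTpχq p i 2)
    (hΔ : (curveχq p i 2).DeltaTemp.map Γ.toMulEquiv.toMonoidHom = (curveχq p i 2).DeltaTemp)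
    (hpar : (levelHom 2 (Γ (SemidirectProduct.inl (gfpOf (FreeGroup.of 0)))).left).y = 0) :
    (ThetaSetting.modelχq p i 2 even_two).GtpYdd.map Γ.toMulEquiv.toMonoidHom ≤
      (ThetaSetting.modelχq p i 2 even_two).GtpYdd := by
  obtain ⟨φ, hφ⟩ := exists_restrict_of_map_deltaTemp_eq p i Γ hΔ
  have hpar' : ZMod.castHom (show ((2 : ℕ+) : ℕ) ∣ ((4 : ℕ+) : ℕ) by norm_num) (ZMod ((2 : ℕ+) : ℕ))
      (levelHom 4 (φ (gfpOf (FreeGroup.of 0)))).y = 0 := by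
    rw [← levelHom_two_y_eq_castHom, ← SemidirectProduct.left_inl (φ := actχq p i 2) (φ _), ← hφ]
    exact hpar
  have hlev : ∀ σ : GQp p, ZHatLevel.level 2 (kappaP p σ ^ i) =
      ZHatLevel.level 2 (kappaP p (Γ (SemidirectProduct.inr σ)).right ^ i) := fun σ => by
    have key := levelChar_four_sub_one_mul_eq p i Γ φ hφ σ
    have hu := ZHatLevel.levelChar_mul_levelChar_inv 4 (chi p (Γ (SemidirectProduct.inr σ)).right)
    rw [zmod_four_sub_one_mul_eq_zero _ _ _ hu hpar'] at key
    rw [map_zpow, map_zpow, level_two_kappaP_eq_of_two_mul_sub_eq_zero p key.symm]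
  rintro _ ⟨g, hg, rfl⟩
  exact apply_mem_GtpYdd_of_level_two_eq p i Γ hΔ hlev hg

/-- `ν` is onto: `ν ((Γ⁻¹ (inr τ)).right) = τ`. [cite: MochizukiEtTh2009, §1 p.12] -/
theorem right_apply_inr_right_symm_apply_inr (Γ : PiTpχq p i 2 ≃ₜ* PiTpχq p i 2) (φ : Gfp ≃ₜ* Gfp)
    (hφ : ∀ q : Gfp, Γ (SemidirectProduct.inl q) = SemidirectProduct.inl (φ q)) (τ : GQp p) :
    (Γ (SemidirectProduct.inr (Γ.symm (SemidirectProduct.inr τ)).right)).right = τ := by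
  have hdec := SemidirectProduct.inl_left_mul_inr_right (Γ.symm (SemidirectProduct.inr τ : PiTpχq p i 2))
  have h := congrArg (fun g => (Γ g).right) hdec
  simp only [map_mul, hφ, SemidirectProduct.mul_right, SemidirectProduct.right_inl, one_mul,
    ContinuousMulEquiv.apply_symm_apply, SemidirectProduct.right_inr] at h
  exact h

/-- **(c, ⇒) For ODD `i`, if some `τ₀ ∈ G_{ℚ_p}` has `χ₄(τ₀) ≠ 1` (⟸ `p ≢ 1 (mod 4)`), then `Γ(Π^tp_Ÿ) ⊆ Π^tp_Ÿ`
FORCES the `b`-exponent of `Γ(a)` to be EVEN**: at `σ₀ := ν⁻¹(τ₀)` the inclusion gives `κ₂(σ₀) = κ₂(τ₀)`, so the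
level-4 relation reads `(χ₄(τ₀) − 1)·y(ĥ₄φ(a)) = 0` with `χ₄(τ₀) = −1`. [cite: MochizukiEtTh2009, Thm 1.6 (i) p.24] -/
theorem levelHom_two_y_eq_zero_of_map_GtpYdd_le (hi : Odd i)
    (hχ : ∃ τ₀ : GQp p, ZHatLevel.levelChar 4 (chi p τ₀) ≠ 1) (Γ : PiTpχq p i 2 ≃ₜ* PiTpχq p i 2)
    (hΔ : (curveχq p i 2).DeltaTemp.map Γ.toMulEquiv.toMonoidHom = (curveχq p i 2).DeltaTemp)
    (hle : (ThetaSetting.modelχq p i 2 even_two).GtpYdd.map Γ.toMulEquiv.toMonoidHom ≤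
      (ThetaSetting.modelχq p i 2 even_two).GtpYdd) :
    (levelHom 2 (Γ (SemidirectProduct.inl (gfpOf (FreeGroup.of 0)))).left).y = 0 := by
  obtain ⟨φ, hφ⟩ := exists_restrict_of_map_deltaTemp_eq p i Γ hΔ
  obtain ⟨τ₀, hτ₀⟩ := hχ
  set σ₀ : GQp p := (Γ.symm (SemidirectProduct.inr τ₀)).right with hσ₀
  have hν : (Γ (SemidirectProduct.inr σ₀)).right = τ₀ := right_apply_inr_right_symm_apply_inr p i Γ φ hφ τ₀
  -- `c σ₀ ∈ Δ^tp_{Y_2}` from the inclusion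
  have hmem : (Γ (SemidirectProduct.inr σ₀)).left ∈ dY 2 := by
    have h1 : (SemidirectProduct.inr σ₀ : PiTpχq p i 2) ∈ (ThetaSetting.modelχq p i 2 even_two).GtpYdd := by
      rw [mem_GtpYdd_modelχq_iff, SemidirectProduct.left_inr]; exact one_mem _
    exact (mem_GtpYdd_modelχq_iff p i _).mp (hle ⟨_, h1, rfl⟩)
  have hlev := (left_apply_inr_mem_dY_two_iff p i Γ φ hφ σ₀).mp hmem
  rw [level_two_zpow_of_odd hi, level_two_zpow_of_odd hi, hν] at hlev
  have key := levelChar_four_sub_one_mul_eq p i Γ φ hφ σ₀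
  rw [hν, two_mul_sub_eq_zero_of_level_two_kappaP_eq p hlev] at key
  have hu := ZHatLevel.levelChar_mul_levelChar_inv 4 (chi p τ₀)
  rw [hφ, SemidirectProduct.left_inl, levelHom_two_y_eq_castHom]
  exact zmod_four_castHom_eq_zero_of_mul_eq_zero _ _ _ hu hτ₀ key

/-- An EVEN `b`-exponent of `Γ(a)` passes to `Γ⁻¹` (then `y(ĥ₂ φ q) = y(ĥ₂ q)` on all of `Γ`). [cite: MochizukiEtTh2009, Thm 1.6 (i) p.24] -/
theorem levelHom_two_y_symm_eq_zero (Γ : PiTpχq p i 2 ≃ₜ* PiTpχq p i 2)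
    (hΔ : (curveχq p i 2).DeltaTemp.map Γ.toMulEquiv.toMonoidHom = (curveχq p i 2).DeltaTemp)
    (hpar : (levelHom 2 (Γ (SemidirectProduct.inl (gfpOf (FreeGroup.of 0)))).left).y = 0) :
    (levelHom 2 (Γ.symm (SemidirectProduct.inl (gfpOf (FreeGroup.of 0)))).left).y = 0 := by
  obtain ⟨φ, hφ⟩ := exists_restrict_of_map_deltaTemp_eq p i Γ hΔ
  set qa : Gfp := gfpOf (FreeGroup.of 0) with hqa
  obtain ⟨Φ, hΦ⟩ := isProfiniteCompletion_gfpFst.exists_extension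
    (⟨gfpFst.toMonoidHom.comp φ.toMulEquiv.toMonoidHom, gfpFst.continuous.comp φ.continuous⟩ : Gfp →ₜ* F₂hatT)
  have hΦ' : ∀ q : Gfp, Φ (gfpFst q) = gfpFst (φ q) := fun q => hΦ q
  obtain ⟨-, hb⟩ := extension_spec φ hΦ'
  have hqa1 : gfpFst qa = eta (FreeGroup.of 0) := rfl
  have hlev : ∀ q : Gfp, levelHom 2 (φ q) = hHat 2 (Φ (gfpFst q)) := fun q => by
    change hHat 2 (gfpFst (φ q)) = _; rw [hΦ']
  have hc₁ : (hHat 2 (Φ (eta (FreeGroup.of 0)))).y = 0 := by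
    rw [← hqa1, ← hlev, ← SemidirectProduct.left_inl (φ := actχq p i 2) (φ qa), ← hφ]; exact hpar
  have hc₂ : (hHat 2 (Φ (eta (FreeGroup.of 1)))).y = 1 := by
    obtain ⟨v, hv⟩ := (isUnit_coeff_of_exists Φ 2 hb).exists_right_inv
    exact zmod_two_eq_one_of_mul_eq_one' _ _ hv
  -- `y ∘ levelHom 2 ∘ φ = y ∘ levelHom 2`
  have hy : ∀ q : Gfp, (levelHom 2 (φ q)).y = (levelHom 2 q).y := fun q => by
    rw [hlev, hHat_y_apply_eq Φ 2, hc₁, hc₂, zero_mul, zero_add, one_mul]; rfl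
  have hsymm : (Γ.symm (SemidirectProduct.inl qa)).left = φ.symm qa := by
    have h := hφ (φ.symm qa)
    rw [φ.apply_symm_apply] at h
    rw [← h, Γ.symm_apply_apply, SemidirectProduct.left_inl]
  rw [hsymm, ← hy, φ.apply_symm_apply, hqa, levelHom_gfpOf_a]

/-- **(c) THE RESIDUAL AT `p ≢ 1 (mod 4)`, ODD `i` (⊇ the instance of record `(i, j) = (1, 2)`).** For a
`Δ^tp_X`-stabilising topological automorphism `Γ` of `Π^tp_X(modelχq p i 2)`:
`Γ(Π^tp_Ÿ) = Π^tp_Ÿ ⟺ the b-exponent of Γ(a) is EVEN` (`y(ĥ₂((Γ (inl a)).left)) = 0`). So at `p ≢ 1 (4)` Thm. 1.6 (i)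
for non-inner `ν` is EXACTLY the parity of `Γ(a)`; whether a `Δ`-stabilising `Γ` of odd parity exists is a
statement about `Aut(G_{ℚ_p})` (gen-5 memo), not decided here. [cite: MochizukiEtTh2009, Thm 1.6 (i) p.24] -/
theorem map_GtpYdd_eq_iff_levelHom_two_y_eq_zero (hi : Odd i) (hp : p % 4 ≠ 1)
    (Γ : PiTpχq p i 2 ≃ₜ* PiTpχq p i 2)
    (hΔ : (curveχq p i 2).DeltaTemp.map Γ.toMulEquiv.toMonoidHom = (curveχq p i 2).DeltaTemp) :
    (ThetaSetting.modelχq p i 2 even_two).GtpYdd.map Γ.toMulEquiv.toMonoidHom =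
        (ThetaSetting.modelχq p i 2 even_two).GtpYdd ↔
      (levelHom 2 (Γ (SemidirectProduct.inl (gfpOf (FreeGroup.of 0)))).left).y = 0 := by
  constructor
  · intro h
    exact levelHom_two_y_eq_zero_of_map_GtpYdd_le p i hi
      (exists_levelChar_four_chi_ne_one_of_mod_four_ne_one p hp) Γ hΔ h.le
  · intro hpar
    refine le_antisymm (map_GtpYdd_le_of_levelHom_two_y_eq_zero p i Γ hΔ hpar) fun g hg => ?_
    exact ⟨Γ.symm g, map_GtpYdd_le_of_levelHom_two_y_eq_zero p i Γ.symm (map_deltaTempχq_symm_eq p i Γ hΔ)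
      (levelHom_two_y_symm_eq_zero p i Γ hΔ hpar) ⟨g, hg, rfl⟩, Γ.apply_symm_apply g⟩


end SettingModel

end Literature.AnabelianGeometry.EtaleTheta

end
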